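/-
Copyright (c) 2026 the pub-hodgecm-mathlib formalisation cell (harness21).  Prover seat hodgecm-mathlib-LH4-p07 (g9), req620 Track A «(D-RAM) FOUR-FRAME» squad
(STAGE-1b, row-(2) lineage LH4-p07; heir dealer∕pen LH4-plan (g13) D-1b draft v2 §3 «counting producers»; default brick (T5-P-axis-Δ) offered 11:02Z), 2026-09-04.
-/
import Summits.HodgeConjecture.HodgeConjecture.Theorems.F0P3cDyRamJointProfileCensusAxisClosedForm   -- ★ p859579 (this seat): (T5-P-axis) FILE 2 — composed axis terms per type, `sum_range_succ_ite_even`, RamK closed forms; brings ★ p859438 FILE 1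
import HarnessLib

/-!
# Crux `H413`, line LH4 «(D-RAM) FOUR-FRAME» — STAGE-1b, row (2): (T5-P-axis-Δ) «THE HYPERBOLIC-MINUS-ANISOTROPIC AXIS DIFFERENCE OF THE `lev_{a,m}` CENSUS, PER THIRD-FIELD TYPE»
# RamK: `AX(h_hyp) = AX(h_an) + 2·Σ_{i ∈ Ico d (J′∕2+1)} q^i` (`= AX(h_an)` below `J′ + 2 ≤ 2d`);  U: `AX(h_hyp) + [J′+d odd]·q^{J′} = AX(h_an) + [J′+d even]·q^{J′}` (`J′ < d`), `AX(h_hyp) + q^{d−1} = AX(h_an) + (q+1)·q^{d−1}·Σ_{k<(J′−d)∕2+1} q^k` (`d ≤ J′`);  RamM: `AX_P = AX_M + 2·q^{s0}·Σ_{i ∈ Ico g ((J′−s0)∕2+1)} q^i`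

Cell `hodgecm-mathlib` (D-0151), FLOOR 0, crux item H413 = `stmt-HodgeConjecture-24833`, route of record `HCCMUnconditional`; squad F0∕P3c∕LH4; lane
`--supports stmt-HodgeConjecture-24833 --as helper` (count-neutral; pays NO tier-0 row).  THEOREMS ONLY (no `def`, no instance, no notation, no `sorry`, default heartbeats).
Consumer: LH4-p04 (g7)'s (C2-lev-X) road (★ p859549 ⟹ the row-(2) letter `hG₂` of LH4-p06 (g6)'s ★ p859526 `hSideLevels_hFamily_of_rows` from ONE two-literal census LAW in the
DIFFERENCE `cnt_{a,b}(ι_w t_h) − cnt_{a,b}(ι_w t_a)`); ★ p859421 ∕ ★ p859485 turn both censuses into ★ p859229 order forms over ONE line model — same `(lam, jλ, n, a, b)`, two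
hermitian scalars `h_hyp`, `h_an` — so the LAW's `G`-side is (AXIS difference) + (CONE difference).  THIS FILE is the AXIS difference in closed form, per type; the cone
difference is the sequel (T5-P-cone).  `AX(h) := Σ_{j ∈ range (J+1)} [IsOrd_j lam ∧ IsOrd_j (c⁻¹(lam − 1)) ∧ IsOrd_j (c′⁻¹(lam − 1)²)]·#levelSet(ρ, Θ, α, ϖE, h; j, 0)`; by ★ p859579
`AX(h) = Σ_{j ≤ J′} row⁰_{type, side(h)}(j)`, `J′ = min(jλ − a, jλ + n − b)`.
* §0 ARITHMETIC (over `ℕ`, subtraction-free: `bigger = smaller + excess` or `x + u = y + v`).  RamK: the hyperbolic a = 0 row is the anisotropic one plus `[j even, 2d ≤ j]·2q^{j∕2}`,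
  summing to `2·Σ_{i ∈ Ico d (N∕2+1)} q^i`.  RamM: excess `[s0 ≤ j, j − s0 even, 2g ≤ j − s0]·2q^{j−(j−s0)∕2}`, summing to `2·q^{s0}·Σ_{i ∈ Ico g ((N−s0)∕2+1)} q^i` (`g ≥ 1`).
  U: below `d` the hyperbolic ∕ anisotropic rows are the EVEN ∕ ODD-parity spheres `u(j) = [j = 0] + [j ≥ 1](q+1)q^{j−1}`, from `d` on the anisotropic row vanishes and the
  hyperbolic one is `[(j+d) even](q+1)q^{(j+d)∕2−1}`; THE ALTERNATING SPHERE IDENTITY `E(N) + [N+d odd]q^N = O(N) + [N+d even]q^N` (`Σ_{j≤N} (−1)^j u(j) = (−1)^N q^N`) and the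
  tail `(q+1)q^{d−1}Σ_{k<(N−d)∕2+1} q^k` give the LOW (`N < d`) and HIGH (`d ≤ N`) regimes.
* §1 COMPOSED WITH ★ p859579 (two scalars `h₁` = hyperbolic side, `h₂` = anisotropic side, every other letter shared; packages VERBATIM): `axis_lev_ramK_hyper_eq_aniso_add`;
  `axis_lev_ramK_eq_of_le (hJd : J′ + 2 ≤ 2d) : AX(h₁) = AX(h₂)` for ANY two `Θ`-fixed non-zero scalars (no side letters — below the threshold the level-piece axis does not see
  the literal); `axis_lev_unr_hyper_add_eq_aniso_add_of_lt ∕ _of_le`; `axis_lev_ramM_hnP_eq_hnM_add` (`dΘ = 2g`, `2d′ = dρ + 2s0`).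
READING.  At types RamK ∕ RamM the two literals' axes agree up to the depth threshold and then differ by a DOUBLED TAIL of the root-ray ball; at type U by the alternating sphere sum
`±q^{J′}` below `d` and by `(q+1)q^{d−1}(1 + ⋯ + q^{(J′−d)∕2}) − q^{d−1}` above — the two tori of `U(2)` in the tree [LabesseLanglands1979, §2], read through the ★ tables; no law asserted.
HONEST LABEL.  Count-neutral arithmetic over ★ organs; nothing printed is asserted; no census law is stated; `HC_CM` is proved only modulo the 7 printed citations (2 remaining named inputs:
hLiu418 = `stmt-HodgeConjecture-24832`, h413 = `stmt-HodgeConjecture-24833`) until rung 0 closes.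

## References
* [Kottwitz1986BaseChangeUnits] R. E. Kottwitz, *Base change for unit elements of Hecke algebras*, Compositio Math. 60 (1986): §1 pp. 240–241.
* [LabesseLanglands1979] J.-P. Labesse, R. P. Langlands, *L-indistinguishability for SL(2)*, Canad. J. Math. 31 (1979): §2 pp. 7–8 (the two tori, alternating counts).
* [Flicker1998UnitaryFL] Y. Z. Flicker, *Elementary proof of the fundamental lemma for a unitary group*, Canad. J. Math. 50 (1998): Prop. 7 p. 84 (the level tables).
* [Serre1979] J.-P. Serre, *Local Fields*, GTM 67 (1979): Ch. III §6 Prop. 12; Ch. V §3.  [Serre1980Trees] J.-P. Serre, *Trees*, Springer (1980): Ch. II §1.1.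
-/

set_option autoImplicit false

open WithZero IsLocalRing
open scoped Valued
open Literature.NumberTheory.Automorphic.UnitaryThreeFourFrame (IsRamifiedQuadraticDatum)
open Summit.HodgeConjecture.HodgeConjecture.Cruxes.H413.F0P3cDyRamToricCensusDefs
open Summit.HodgeConjecture.HodgeConjecture.Cruxes.H413.F0P3cDyRamJointProfileCensusAxisClosedForm

namespace Summit.HodgeConjecture.HodgeConjecture.Cruxes.H413.F0P3cDyRamJointProfileCensusAxisDifference

/-! ## §0 Arithmetic: the three row differences, subtraction-free -/

/-- **RamK, POINTWISE**: the hyperbolic a = 0 row is the anisotropic one plus the doubled level `[j even, 2d ≤ j]·2q^{j∕2}` (`d ≥ 1`). [cite: Flicker1998UnitaryFL, Prop. 7 p. 84] -/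
theorem ramK_hyper_rowZero_eq_aniso_add (q j : ℕ) {d : ℕ} (hd : 1 ≤ d) :
    (if j = 0 then 1 else if j % 2 = 1 then 0 else (if 2 * d ≤ j + 1 then 2 else 1) * q ^ (j / 2)) =
      (if j = 0 then 1 else if j % 2 = 1 then 0 else if j + 2 ≤ 2 * d then q ^ (j / 2) else 0) +
        (if j % 2 = 0 ∧ 2 * d ≤ j then 2 * q ^ (j / 2) else 0) := by
  by_cases hj0 : j = 0
  · subst hj0; simp [show ¬ 2 * d ≤ 0 by omega]
  · by_cases hpar : j % 2 = 1
    · simp [hj0, hpar]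
    · have hpar0 : j % 2 = 0 := by omega
      by_cases hdj : 2 * d ≤ j
      · simp [hj0, hpar0, hdj, show 2 * d ≤ j + 1 by omega, show ¬ j + 2 ≤ 2 * d by omega]
      · simp [hj0, hpar0, hdj, show ¬ 2 * d ≤ j + 1 by omega, show j + 2 ≤ 2 * d by omega]

/-- **RamK, THE DOUBLED TAIL SUMMED**: `Σ_{j ≤ N} [j even, 2d ≤ j]·2q^{j∕2} = 2·Σ_{i ∈ Ico d (N∕2+1)} q^i`. [cite: Serre1980Trees, Ch. II §1.1] -/
theorem sum_ite_even_and_le_eq (q n d : ℕ) :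
    ∑ j ∈ Finset.range (n + 1), (if j % 2 = 0 ∧ 2 * d ≤ j then 2 * q ^ (j / 2) else 0) = 2 * ∑ i ∈ Finset.Ico d (n / 2 + 1), q ^ i := by
  have hpt : ∀ j, (if j % 2 = 0 ∧ 2 * d ≤ j then 2 * q ^ (j / 2) else 0) = if j % 2 = 0 then (if d ≤ j / 2 then 2 * q ^ (j / 2) else 0) else 0 := by
    intro j
    by_cases hpar : j % 2 = 0
    · by_cases hdj : 2 * d ≤ j
      · simp [hpar, hdj, show d ≤ j / 2 by omega]
      · simp [hpar, hdj, show ¬ d ≤ j / 2 by omega]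
    · simp [hpar]
  rw [Finset.sum_congr rfl fun j _ => hpt j, sum_range_succ_ite_even (fun i => if d ≤ i then 2 * q ^ i else 0) n, ← Finset.sum_filter,
    Finset.range_eq_Ico, Finset.Ico_filter_le, Finset.mul_sum]
  simp

/-- **RamK, SUMMED**: `Σ_{j ≤ N} row⁰_hyp = Σ_{j ≤ N} row⁰_an + 2·Σ_{i ∈ Ico d (N∕2+1)} q^i` (`d ≥ 1`). [cite: Flicker1998UnitaryFL, Prop. 7 p. 84] [cite: Serre1980Trees, Ch. II §1.1] -/
theorem sum_ramK_hyper_rowZero_eq_sum_aniso_add (q n : ℕ) {d : ℕ} (hd : 1 ≤ d) :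
    ∑ j ∈ Finset.range (n + 1), (if j = 0 then 1 else if j % 2 = 1 then 0 else (if 2 * d ≤ j + 1 then 2 else 1) * q ^ (j / 2)) =
      ∑ j ∈ Finset.range (n + 1), (if j = 0 then 1 else if j % 2 = 1 then 0 else if j + 2 ≤ 2 * d then q ^ (j / 2) else 0) +
        2 * ∑ i ∈ Finset.Ico d (n / 2 + 1), q ^ i := by
  rw [← sum_ite_even_and_le_eq q n d, ← Finset.sum_add_distrib]
  exact Finset.sum_congr rfl fun j _ => ramK_hyper_rowZero_eq_aniso_add q j hd

/-- **RamM, POINTWISE**: the `hnP` a = 0 row is the `hnM` row plus the doubled level `[s0 ≤ j, j − s0 even, 2g ≤ j − s0]·2q^{j−(j−s0)∕2}` (`s0 ≥ 1`). [cite: Flicker1998UnitaryFL, Prop. 7 p. 84] [cite: Serre1979, Ch. V §3] -/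
theorem ramM_rowZero_hnP_eq_hnM_add (q j g : ℕ) {s0 : ℕ} (hs1 : 1 ≤ s0) :
    (if j = 0 then 1 else if j + 1 = s0 then q ^ j else if j + 1 < s0 then q ^ j else if (j - s0) % 2 = 1 then 0 else (if 2 * g ≤ j - s0 then 2 else 1) * q ^ (j - (j - s0) / 2)) =
      (if j = 0 then 1 else if j + 1 = s0 then q ^ j else if j + 1 < s0 then q ^ j else if (j - s0) % 2 = 1 then 0 else if j - s0 + 2 ≤ 2 * g then q ^ (j - (j - s0) / 2) else 0) +
        (if s0 ≤ j ∧ (j - s0) % 2 = 0 ∧ 2 * g ≤ j - s0 then 2 * q ^ (j - (j - s0) / 2) else 0) := by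
  by_cases hj0 : j = 0
  · subst hj0; simp [show ¬ s0 ≤ 0 by omega]
  · by_cases hj1 : j + 1 = s0
    · simp [hj0, hj1, show ¬ s0 ≤ j by omega]
    · by_cases hj2 : j + 1 < s0
      · simp [hj0, hj1, hj2, show ¬ s0 ≤ j by omega]
      · have hsj : s0 ≤ j := by omega
        by_cases hpar : (j - s0) % 2 = 1
        · simp [hj0, hj1, hj2, hpar]
        · have hpar0 : (j - s0) % 2 = 0 := by omega
          by_cases hgj : 2 * g ≤ j - s0
          · simp [hj0, hj1, hj2, hpar, hgj, show ¬ j - s0 + 2 ≤ 2 * g by omega, hsj]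
          · simp [hj0, hj1, hj2, hpar, hgj, show j - s0 + 2 ≤ 2 * g by omega]

/-- **RamM, THE DOUBLED TAIL SUMMED**: `Σ_{j ≤ N} [s0 ≤ j, j − s0 even, 2g ≤ j − s0]·2q^{j−(j−s0)∕2} = 2·q^{s0}·Σ_{i ∈ Ico g ((N−s0)∕2+1)} q^i` (`g ≥ 1`; for `N < s0` both sides vanish).
[cite: Serre1980Trees, Ch. II §1.1] -/
theorem sum_ite_ramM_tail_eq (q n : ℕ) {g : ℕ} (hg : 1 ≤ g) (s0 : ℕ) :
    ∑ j ∈ Finset.range (n + 1), (if s0 ≤ j ∧ (j - s0) % 2 = 0 ∧ 2 * g ≤ j - s0 then 2 * q ^ (j - (j - s0) / 2) else 0) =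
      2 * q ^ s0 * ∑ i ∈ Finset.Ico g ((n - s0) / 2 + 1), q ^ i := by
  rcases lt_or_ge n s0 with hns | hns
  · rw [Finset.sum_eq_zero fun j hj => ?_, show n - s0 = 0 by omega, Finset.Ico_eq_empty_of_le (by omega), Finset.sum_empty, mul_zero]
    rw [Finset.mem_range] at hj
    have : ¬ s0 ≤ j := by omega
    simp [this]
  · rw [← Finset.sum_range_add_sum_Ico _ (show s0 ≤ n + 1 by omega), Finset.sum_eq_zero fun j hj => ?_, zero_add,
      Finset.sum_Ico_eq_sum_range, show n + 1 - s0 = (n - s0) + 1 by omega]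
    · have hpt : ∀ k, (if s0 ≤ s0 + k ∧ (s0 + k - s0) % 2 = 0 ∧ 2 * g ≤ s0 + k - s0 then 2 * q ^ (s0 + k - (s0 + k - s0) / 2) else 0) =
          if k % 2 = 0 then (if g ≤ k / 2 then 2 * q ^ s0 * q ^ (k / 2) else 0) else 0 := by
        intro k
        rw [Nat.add_sub_cancel_left]
        by_cases hpar : k % 2 = 0
        · by_cases hgk : 2 * g ≤ k
          · simp [hpar, hgk, show g ≤ k / 2 by omega, show s0 + k - k / 2 = s0 + k / 2 by omega, pow_add, mul_assoc]
          · simp [hpar, hgk, show ¬ g ≤ k / 2 by omega]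
        · simp [hpar]
      rw [Finset.sum_congr rfl fun k _ => hpt k, sum_range_succ_ite_even (fun i => if g ≤ i then 2 * q ^ s0 * q ^ i else 0) (n - s0),
        ← Finset.sum_filter, Finset.range_eq_Ico, Finset.Ico_filter_le, Finset.mul_sum]
      simp
    · rw [Finset.mem_range] at hj
      have : ¬ s0 ≤ j := by omega
      simp [this]

/-- **RamM, SUMMED**: `Σ_{j ≤ N} row⁰_P = Σ_{j ≤ N} row⁰_M + 2·q^{s0}·Σ_{i ∈ Ico g ((N−s0)∕2+1)} q^i` (`g, s0 ≥ 1`). [cite: Flicker1998UnitaryFL, Prop. 7 p. 84] [cite: Serre1979, Ch. V §3] -/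
theorem sum_ramM_rowZero_hnP_eq_sum_hnM_add (q n : ℕ) {g s0 : ℕ} (hg : 1 ≤ g) (hs1 : 1 ≤ s0) :
    ∑ j ∈ Finset.range (n + 1), (if j = 0 then 1 else if j + 1 = s0 then q ^ j else if j + 1 < s0 then q ^ j else if (j - s0) % 2 = 1 then 0 else (if 2 * g ≤ j - s0 then 2 else 1) * q ^ (j - (j - s0) / 2)) =
      ∑ j ∈ Finset.range (n + 1), (if j = 0 then 1 else if j + 1 = s0 then q ^ j else if j + 1 < s0 then q ^ j else if (j - s0) % 2 = 1 then 0 else if j - s0 + 2 ≤ 2 * g then q ^ (j - (j - s0) / 2) else 0) +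
        2 * q ^ s0 * ∑ i ∈ Finset.Ico g ((n - s0) / 2 + 1), q ^ i := by
  rw [← sum_ite_ramM_tail_eq q n hg s0, ← Finset.sum_add_distrib]
  exact Finset.sum_congr rfl fun j _ => ramM_rowZero_hnP_eq_hnM_add q j g hs1

/-- **U, POINTWISE below `d`, HYPERBOLIC**: the row is the EVEN-parity sphere `[(j+d) even]·u(j)`, `u(j) = [j = 0] + [j ≥ 1](q+1)q^{j−1}`. [cite: Flicker1998UnitaryFL, Prop. 7 p. 84] [cite: Serre1980Trees, Ch. II §1.1] -/
theorem unr_hyper_rowZero_of_lt (q : ℕ) {j d : ℕ} (hjd : j < d) :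
    (if (j + d) % 2 = 0 then (if d ≤ j then (q + 1) * q ^ ((j + d) / 2 - 1) else (if j = 0 then 1 else (q + 1) * q ^ (j - 1))) else 0) =
      if (j + d) % 2 = 0 then (if j = 0 then 1 else (q + 1) * q ^ (j - 1)) else 0 := by
  have : ¬ d ≤ j := by omega
  simp [this]

/-- **U, POINTWISE below `d`, ANISOTROPIC**: the row is the ODD-parity sphere `[(j+d) odd]·u(j)`. [cite: Flicker1998UnitaryFL, Prop. 7 p. 84] [cite: Serre1980Trees, Ch. II §1.1] -/
theorem unr_aniso_rowZero_of_lt (q : ℕ) {j d : ℕ} (hjd : j < d) :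
    (if d = j + 1 ∨ (j + 1 < d ∧ (j + d) % 2 = 1) then (if j = 0 then 1 else (q + 1) * q ^ (j - 1)) else 0) =
      if (j + d) % 2 = 1 then (if j = 0 then 1 else (q + 1) * q ^ (j - 1)) else 0 := by
  by_cases h : (j + d) % 2 = 1
  · have h' : d = j + 1 ∨ (j + 1 < d ∧ (j + d) % 2 = 1) := by omega
    rw [if_pos h', if_pos h]
  · have h' : ¬ (d = j + 1 ∨ (j + 1 < d ∧ (j + d) % 2 = 1)) := by omega
    rw [if_neg h', if_neg h]

/-- **U, POINTWISE from `d` on, ANISOTROPIC**: the row vanishes. [cite: Flicker1998UnitaryFL, Prop. 7 p. 84] -/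
theorem unr_aniso_rowZero_of_le (q : ℕ) {j d : ℕ} (hdj : d ≤ j) :
    (if d = j + 1 ∨ (j + 1 < d ∧ (j + d) % 2 = 1) then (if j = 0 then 1 else (q + 1) * q ^ (j - 1)) else 0) = 0 := by
  have h' : ¬ (d = j + 1 ∨ (j + 1 < d ∧ (j + d) % 2 = 1)) := by omega
  rw [if_neg h']

/-- **U, POINTWISE from `d` on, HYPERBOLIC**: the row is `[(j+d) even]·(q+1)q^{(j+d)∕2−1}`. [cite: Flicker1998UnitaryFL, Prop. 7 p. 84] -/
theorem unr_hyper_rowZero_of_le (q : ℕ) {j d : ℕ} (hdj : d ≤ j) :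
    (if (j + d) % 2 = 0 then (if d ≤ j then (q + 1) * q ^ ((j + d) / 2 - 1) else (if j = 0 then 1 else (q + 1) * q ^ (j - 1))) else 0) =
      if (j + d) % 2 = 0 then (q + 1) * q ^ ((j + d) / 2 - 1) else 0 := by
  simp [hdj]

/-- **THE ALTERNATING SPHERE IDENTITY**: `E(N) + [N+d odd]·q^N = O(N) + [N+d even]·q^N`, `E ∕ O` the even ∕ odd-parity sphere sums `Σ_{j ≤ N} [(j+d) ≡ 0 ∕ 1]·u(j)` — i.e.
`Σ_{j ≤ N} (−1)^j u(j) = (−1)^N q^N` in the `(q+1)`-regular tree, subtraction-free. [cite: LabesseLanglands1979, §2 pp. 7–8] [cite: Serre1980Trees, Ch. II §1.1] -/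
theorem sum_unr_spheres_alternating (q d N : ℕ) :
    ∑ j ∈ Finset.range (N + 1), (if (j + d) % 2 = 0 then (if j = 0 then 1 else (q + 1) * q ^ (j - 1)) else 0) + (if (N + d) % 2 = 1 then q ^ N else 0) =
      ∑ j ∈ Finset.range (N + 1), (if (j + d) % 2 = 1 then (if j = 0 then 1 else (q + 1) * q ^ (j - 1)) else 0) + (if (N + d) % 2 = 0 then q ^ N else 0) := by
  induction N with
  | zero =>
    rw [Finset.sum_range_one, Finset.sum_range_one]
    by_cases h : d % 2 = 0
    · simp [h]
    · have h' : d % 2 = 1 := by omega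
      simp [h']
  | succ N ih =>
    rw [Finset.sum_range_succ _ (N + 1), Finset.sum_range_succ _ (N + 1)]
    have hN1 : ¬ N + 1 = 0 := by omega
    have key : (q + 1) * q ^ N = q ^ N + q ^ (N + 1) := by ring
    by_cases h : (N + 1 + d) % 2 = 0
    · have h1 : ¬ (N + 1 + d) % 2 = 1 := by omega
      have h2 : (N + d) % 2 = 1 := by omega
      have h3 : ¬ (N + d) % 2 = 0 := by omega
      rw [if_pos h2, if_neg h3] at ih
      simp only [if_pos h, if_neg h1, if_neg hN1, Nat.add_sub_cancel, add_zero]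
      omega
    · have h1 : (N + 1 + d) % 2 = 1 := by omega
      have h2 : ¬ (N + d) % 2 = 1 := by omega
      have h3 : (N + d) % 2 = 0 := by omega
      rw [if_neg h2, if_pos h3] at ih
      simp only [if_neg h, if_pos h1, if_neg hN1, Nat.add_sub_cancel, add_zero]
      omega

/-- **U, THE HYPERBOLIC TAIL SUMMED**: `Σ_{j ∈ Ico d (N+1)} [(j+d) even]·(q+1)q^{(j+d)∕2−1} = (q+1)·q^{d−1}·Σ_{k<(N−d)∕2+1} q^k` (`1 ≤ d ≤ N`). [cite: Serre1980Trees, Ch. II §1.1] -/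
theorem sum_unr_hyper_tail_eq (q : ℕ) {d N : ℕ} (hd : 1 ≤ d) (hdN : d ≤ N) :
    ∑ j ∈ Finset.Ico d (N + 1), (if (j + d) % 2 = 0 then (q + 1) * q ^ ((j + d) / 2 - 1) else 0) =
      (q + 1) * q ^ (d - 1) * ∑ k ∈ Finset.range ((N - d) / 2 + 1), q ^ k := by
  rw [Finset.sum_Ico_eq_sum_range, show N + 1 - d = (N - d) + 1 by omega]
  have hpt : ∀ k, (if (d + k + d) % 2 = 0 then (q + 1) * q ^ ((d + k + d) / 2 - 1) else 0) =
      if k % 2 = 0 then (q + 1) * q ^ (d - 1) * q ^ (k / 2) else 0 := by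
    intro k
    by_cases hk : k % 2 = 0
    · have h1 : (d + k + d) % 2 = 0 := by omega
      have h2 : (d + k + d) / 2 - 1 = (d - 1) + k / 2 := by omega
      rw [if_pos h1, if_pos hk, h2, pow_add, mul_assoc]
    · have h1 : ¬ (d + k + d) % 2 = 0 := by omega
      rw [if_neg h1, if_neg hk]
  rw [Finset.sum_congr rfl fun k _ => hpt k, sum_range_succ_ite_even (fun i => (q + 1) * q ^ (d - 1) * q ^ i) (N - d), Finset.mul_sum]

/-- **U, SUMMED, LOW REGIME `N < d`**: `Σ_{j ≤ N} row⁰_hyp + [N+d odd]·q^N = Σ_{j ≤ N} row⁰_an + [N+d even]·q^N`. [cite: LabesseLanglands1979, §2 pp. 7–8] [cite: Flicker1998UnitaryFL, Prop. 7 p. 84] -/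
theorem sum_unr_hyper_rowZero_add_eq_low (q : ℕ) {d N : ℕ} (hN : N < d) :
    ∑ j ∈ Finset.range (N + 1), (if (j + d) % 2 = 0 then (if d ≤ j then (q + 1) * q ^ ((j + d) / 2 - 1) else (if j = 0 then 1 else (q + 1) * q ^ (j - 1))) else 0) +
        (if (N + d) % 2 = 1 then q ^ N else 0) =
      ∑ j ∈ Finset.range (N + 1), (if d = j + 1 ∨ (j + 1 < d ∧ (j + d) % 2 = 1) then (if j = 0 then 1 else (q + 1) * q ^ (j - 1)) else 0) +
        (if (N + d) % 2 = 0 then q ^ N else 0) := by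
  rw [Finset.sum_congr rfl fun j hj => unr_hyper_rowZero_of_lt q (show j < d by rw [Finset.mem_range] at hj; omega),
    Finset.sum_congr rfl fun j hj => unr_aniso_rowZero_of_lt q (show j < d by rw [Finset.mem_range] at hj; omega)]
  exact sum_unr_spheres_alternating q d N

/-- **U, SUMMED, HIGH REGIME `d ≤ N`** (`d ≥ 1`): `Σ_{j ≤ N} row⁰_hyp + q^{d−1} = Σ_{j ≤ N} row⁰_an + (q+1)·q^{d−1}·Σ_{k<(N−d)∕2+1} q^k`.
[cite: LabesseLanglands1979, §2 pp. 7–8] [cite: Flicker1998UnitaryFL, Prop. 7 p. 84] [cite: Serre1980Trees, Ch. II §1.1] -/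
theorem sum_unr_hyper_rowZero_add_eq_high (q : ℕ) {d N : ℕ} (hd : 1 ≤ d) (hdN : d ≤ N) :
    ∑ j ∈ Finset.range (N + 1), (if (j + d) % 2 = 0 then (if d ≤ j then (q + 1) * q ^ ((j + d) / 2 - 1) else (if j = 0 then 1 else (q + 1) * q ^ (j - 1))) else 0) +
        q ^ (d - 1) =
      ∑ j ∈ Finset.range (N + 1), (if d = j + 1 ∨ (j + 1 < d ∧ (j + d) % 2 = 1) then (if j = 0 then 1 else (q + 1) * q ^ (j - 1)) else 0) +
        (q + 1) * q ^ (d - 1) * ∑ k ∈ Finset.range ((N - d) / 2 + 1), q ^ k := by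
  rw [← Finset.sum_range_add_sum_Ico _ (show d ≤ N + 1 by omega), ← Finset.sum_range_add_sum_Ico _ (show d ≤ N + 1 by omega)]
  have hlow := sum_unr_hyper_rowZero_add_eq_low q (show d - 1 < d by omega)
  rw [show d - 1 + 1 = d by omega, if_pos (show (d - 1 + d) % 2 = 1 by omega), if_neg (show ¬ (d - 1 + d) % 2 = 0 by omega), add_zero] at hlow
  have hSa : ∑ j ∈ Finset.Ico d (N + 1), (if d = j + 1 ∨ (j + 1 < d ∧ (j + d) % 2 = 1) then (if j = 0 then 1 else (q + 1) * q ^ (j - 1)) else 0) = 0 :=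
    Finset.sum_eq_zero fun j hj => unr_aniso_rowZero_of_le q (show d ≤ j by rw [Finset.mem_Ico] at hj; omega)
  have hSh : ∑ j ∈ Finset.Ico d (N + 1), (if (j + d) % 2 = 0 then (if d ≤ j then (q + 1) * q ^ ((j + d) / 2 - 1) else (if j = 0 then 1 else (q + 1) * q ^ (j - 1))) else 0) =
      (q + 1) * q ^ (d - 1) * ∑ k ∈ Finset.range ((N - d) / 2 + 1), q ^ k := by
    rw [Finset.sum_congr rfl fun j hj => unr_hyper_rowZero_of_le q (show d ≤ j by rw [Finset.mem_Ico] at hj; omega)]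
    exact sum_unr_hyper_tail_eq q hd hdN
  rw [hSa, hSh, add_zero, add_right_comm, hlow]

/-! ## §1 Composed: the axis difference of the two literals, per type (★ p859579 with two hermitian scalars) -/

variable {K : Type} [Field K] [Valued K ℤᵐ⁰] {ρ Θ : K →+* K} {α ϖE : K}

open scoped Classical in
/-- **(T5-P-axis-Δ) TYPE RamK**: for a HYPERBOLIC scalar `h₁` and an ANISOTROPIC scalar `h₂` over one line model, `AX(h₁) = AX(h₂) + 2·Σ_{i ∈ Ico d (J′∕2+1)} q^i` (`J′ = min(jλ − a, jλ + n − b)`;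
package of ★ `ncard_levelSet_ramK_*_of_frame` VERBATIM, the two side letters, then ★ p859438's §1 tokens). [cite: Kottwitz1986BaseChangeUnits, §1 pp. 240–241] [cite: Flicker1998UnitaryFL, Prop. 7 p. 84] -/
theorem axis_lev_ramK_hyper_eq_aniso_add [CompleteSpace K] [IsDiscreteValuationRing 𝒪[K]] [Finite 𝓀[K]]
    (hρρ : ∀ x, ρ (ρ x) = x) (hvρ : ∀ x, Valued.v (ρ x) = Valued.v x) (hΘρ : ∀ x, Θ (ρ x) = ρ (Θ x))
    (hα1 : Valued.v α ≤ 1) (hα : Valued.v (α - ρ α) = 1) {d t : ℕ} (hD : IsRamifiedQuadraticDatum Θ ϖE d t) (hρϖ : ρ ϖE = ϖE)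
    {q : ℕ} (hq : Nat.card 𝓀[K] = q ^ 2)
    (hσres : ∀ z : K, ρ z = z → Valued.v z ≤ 1 → Valued.v (Θ z - z) < 1) (hram : Valued.v (α - Θ α) < 1)
    {h₁ : K} (hΘh₁ : Θ h₁ = h₁) (hh₁ : h₁ ≠ 0) (hhyper : ∃ x : K, x ≠ 0 ∧ h₁ * Θ x * x + ρ (h₁ * Θ x * x) = 0)
    {h₂ : K} (hΘh₂ : Θ h₂ = h₂) (hh₂ : h₂ ≠ 0) (haniso : ¬ ∃ x : K, x ≠ 0 ∧ h₂ * Θ x * x + ρ (h₂ * Θ x * x) = 0)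
    {lam : K} (hlam1 : Valued.v lam ≤ 1) {jl : ℕ} (hjl : Valued.v (lam - ρ lam) = Valued.v ϖE ^ jl * Valued.v (α - ρ α))
    {c : K} (hρc : ρ c = c) {a : ℕ} (hc : Valued.v c = Valued.v ϖE ^ a) (hlev : Valued.v (lam - 1) ≤ Valued.v c) (hajl : a ≤ jl)
    {c' : K} (hρc' : ρ c' = c') {b : ℕ} (hc' : Valued.v c' = Valued.v ϖE ^ b) (hlev2 : Valued.v ((lam - 1) * (lam - 1)) ≤ Valued.v c')
    {n : ℕ} (hn : Valued.v (lam + ρ lam - 2) = Valued.v ϖE ^ n) (hb : b ≤ jl + n) {J : ℕ} (hJ : jl ≤ J) :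
    ∑ j ∈ Finset.range (J + 1),
        (if IsOrd ρ α (ϖE ^ j) lam ∧ IsOrd ρ α (ϖE ^ j) (c⁻¹ * (lam - 1)) ∧ IsOrd ρ α (ϖE ^ j) (c'⁻¹ * ((lam - 1) * (lam - 1))) then
          (levelSet ρ Θ α ϖE h₁ j 0).ncard else 0) =
      ∑ j ∈ Finset.range (J + 1),
        (if IsOrd ρ α (ϖE ^ j) lam ∧ IsOrd ρ α (ϖE ^ j) (c⁻¹ * (lam - 1)) ∧ IsOrd ρ α (ϖE ^ j) (c'⁻¹ * ((lam - 1) * (lam - 1))) then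
          (levelSet ρ Θ α ϖE h₂ j 0).ncard else 0) +
        2 * ∑ i ∈ Finset.Ico d (min (jl - a) (jl + n - b) / 2 + 1), q ^ i := by
  rw [axis_lev_eq_sum_table_ramK_hyper hρρ hvρ hΘρ hα1 hα hD hρϖ hΘh₁ hh₁ hq hσres hram hhyper hlam1 hjl hρc hc hlev hajl hρc' hc' hlev2 hn hb hJ,
    axis_lev_eq_sum_table_ramK_aniso hρρ hvρ hΘρ hα1 hα hD hρϖ hΘh₂ hh₂ hq hσres hram haniso hlam1 hjl hρc hc hlev hajl hρc' hc' hlev2 hn hb hJ,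
    sum_ramK_hyper_rowZero_eq_sum_aniso_add q _ hD.2.2.2.2.2.1]

open scoped Classical in
/-- **(T5-P-axis-Δ) TYPE RamK BELOW THE THRESHOLD — THE AXIS DOES NOT SEE THE LITERAL**: for ANY two `Θ`-fixed non-zero hermitian scalars `h₁ h₂` (no side letters),
`J′ + 2 ≤ 2d ⇒ AX(h₁) = AX(h₂)` (both are the ball count `Σ_{i ≤ J′∕2} q^i` by ★ `axis_lev_eq_geom_ramK_of_le`). [cite: Kottwitz1986BaseChangeUnits, §1 pp. 240–241] [cite: Flicker1998UnitaryFL, Prop. 7 p. 84] -/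
theorem axis_lev_ramK_eq_of_le [CompleteSpace K] [IsDiscreteValuationRing 𝒪[K]] [Finite 𝓀[K]]
    (hρρ : ∀ x, ρ (ρ x) = x) (hvρ : ∀ x, Valued.v (ρ x) = Valued.v x) (hΘρ : ∀ x, Θ (ρ x) = ρ (Θ x))
    (hα1 : Valued.v α ≤ 1) (hα : Valued.v (α - ρ α) = 1) {d t : ℕ} (hD : IsRamifiedQuadraticDatum Θ ϖE d t) (hρϖ : ρ ϖE = ϖE)
    {q : ℕ} (hq : Nat.card 𝓀[K] = q ^ 2)
    (hσres : ∀ z : K, ρ z = z → Valued.v z ≤ 1 → Valued.v (Θ z - z) < 1) (hram : Valued.v (α - Θ α) < 1)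
    {h₁ : K} (hΘh₁ : Θ h₁ = h₁) (hh₁ : h₁ ≠ 0) {h₂ : K} (hΘh₂ : Θ h₂ = h₂) (hh₂ : h₂ ≠ 0)
    {lam : K} (hlam1 : Valued.v lam ≤ 1) {jl : ℕ} (hjl : Valued.v (lam - ρ lam) = Valued.v ϖE ^ jl * Valued.v (α - ρ α))
    {c : K} (hρc : ρ c = c) {a : ℕ} (hc : Valued.v c = Valued.v ϖE ^ a) (hlev : Valued.v (lam - 1) ≤ Valued.v c) (hajl : a ≤ jl)
    {c' : K} (hρc' : ρ c' = c') {b : ℕ} (hc' : Valued.v c' = Valued.v ϖE ^ b) (hlev2 : Valued.v ((lam - 1) * (lam - 1)) ≤ Valued.v c')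
    {n : ℕ} (hn : Valued.v (lam + ρ lam - 2) = Valued.v ϖE ^ n) (hb : b ≤ jl + n) {J : ℕ} (hJ : jl ≤ J)
    (hJd : min (jl - a) (jl + n - b) + 2 ≤ 2 * d) :
    ∑ j ∈ Finset.range (J + 1),
        (if IsOrd ρ α (ϖE ^ j) lam ∧ IsOrd ρ α (ϖE ^ j) (c⁻¹ * (lam - 1)) ∧ IsOrd ρ α (ϖE ^ j) (c'⁻¹ * ((lam - 1) * (lam - 1))) then
          (levelSet ρ Θ α ϖE h₁ j 0).ncard else 0) =
      ∑ j ∈ Finset.range (J + 1),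
        (if IsOrd ρ α (ϖE ^ j) lam ∧ IsOrd ρ α (ϖE ^ j) (c⁻¹ * (lam - 1)) ∧ IsOrd ρ α (ϖE ^ j) (c'⁻¹ * ((lam - 1) * (lam - 1))) then
          (levelSet ρ Θ α ϖE h₂ j 0).ncard else 0) := by
  rw [axis_lev_eq_geom_ramK_of_le hρρ hvρ hΘρ hα1 hα hD hρϖ hΘh₁ hh₁ hq hσres hram hlam1 hjl hρc hc hlev hajl hρc' hc' hlev2 hn hb hJ hJd,
    axis_lev_eq_geom_ramK_of_le hρρ hvρ hΘρ hα1 hα hD hρϖ hΘh₂ hh₂ hq hσres hram hlam1 hjl hρc hc hlev hajl hρc' hc' hlev2 hn hb hJ hJd]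

open scoped Classical in
/-- **(T5-P-axis-Δ) TYPE U, LOW REGIME `J′ < d`**: `AX(h₁) + [J′+d odd]·q^{J′} = AX(h₂) + [J′+d even]·q^{J′}` (hyperbolic `h₁`, anisotropic `h₂`; the alternating sphere identity;
package of ★ `ncard_levelSet_unr_*_of_frame` VERBATIM, then ★ p859438's §1 tokens). [cite: Kottwitz1986BaseChangeUnits, §1 pp. 240–241] [cite: LabesseLanglands1979, §2 pp. 7–8] -/
theorem axis_lev_unr_hyper_add_eq_aniso_add_of_lt {d q : ℕ} [CompleteSpace K] [IsDiscreteValuationRing 𝒪[K]] [Finite 𝓀[K]]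
    (hρρ : ∀ x, ρ (ρ x) = x) (hvρ : ∀ x, Valued.v (ρ x) = Valued.v x) (hΘΘ : ∀ x, Θ (Θ x) = x) (hΘρ : ∀ x, Θ (ρ x) = ρ (Θ x))
    (hvΘ : ∀ x, Valued.v (Θ x) = Valued.v x) (hα1 : Valued.v α ≤ 1) (hα : Valued.v (α - ρ α) = 1)
    (hρϖE : ρ ϖE = ϖE) (hϖE : Valued.v ϖE = exp (-1 : ℤ)) (hq : Nat.card 𝓀[K] = q ^ 2)
    (hτα : Valued.v (ρ α - Θ α) < 1) (hd : 1 ≤ d) (hddE : Valued.v (ϖE - Θ ϖE) = Valued.v ϖE ^ d)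
    (hfixE : ∀ z : K, ρ z = z → Θ z = z → z ≠ 0 → ∃ n : ℤ, Valued.v z = exp (2 * n))
    {h₁ : K} (hΘh₁ : Θ h₁ = h₁) (hh₁ : h₁ ≠ 0) (hhyper : ∃ x : K, x ≠ 0 ∧ h₁ * Θ x * x + ρ (h₁ * Θ x * x) = 0)
    {h₂ : K} (hΘh₂ : Θ h₂ = h₂) (hh₂ : h₂ ≠ 0) (haniso : ¬ ∃ x : K, x ≠ 0 ∧ h₂ * Θ x * x + ρ (h₂ * Θ x * x) = 0)
    {lam : K} (hlam1 : Valued.v lam ≤ 1) {jl : ℕ} (hjl : Valued.v (lam - ρ lam) = Valued.v ϖE ^ jl * Valued.v (α - ρ α))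
    {c : K} (hρc : ρ c = c) {a : ℕ} (hc : Valued.v c = Valued.v ϖE ^ a) (hlev : Valued.v (lam - 1) ≤ Valued.v c) (hajl : a ≤ jl)
    {c' : K} (hρc' : ρ c' = c') {b : ℕ} (hc' : Valued.v c' = Valued.v ϖE ^ b) (hlev2 : Valued.v ((lam - 1) * (lam - 1)) ≤ Valued.v c')
    {n : ℕ} (hn : Valued.v (lam + ρ lam - 2) = Valued.v ϖE ^ n) (hb : b ≤ jl + n) {J : ℕ} (hJ : jl ≤ J)
    (hJd : min (jl - a) (jl + n - b) < d) :
    ∑ j ∈ Finset.range (J + 1),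
        (if IsOrd ρ α (ϖE ^ j) lam ∧ IsOrd ρ α (ϖE ^ j) (c⁻¹ * (lam - 1)) ∧ IsOrd ρ α (ϖE ^ j) (c'⁻¹ * ((lam - 1) * (lam - 1))) then
          (levelSet ρ Θ α ϖE h₁ j 0).ncard else 0) +
        (if (min (jl - a) (jl + n - b) + d) % 2 = 1 then q ^ min (jl - a) (jl + n - b) else 0) =
      ∑ j ∈ Finset.range (J + 1),
        (if IsOrd ρ α (ϖE ^ j) lam ∧ IsOrd ρ α (ϖE ^ j) (c⁻¹ * (lam - 1)) ∧ IsOrd ρ α (ϖE ^ j) (c'⁻¹ * ((lam - 1) * (lam - 1))) then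
          (levelSet ρ Θ α ϖE h₂ j 0).ncard else 0) +
        (if (min (jl - a) (jl + n - b) + d) % 2 = 0 then q ^ min (jl - a) (jl + n - b) else 0) := by
  rw [axis_lev_eq_sum_table_unr_hyper hρρ hvρ hΘΘ hΘρ hvΘ hα1 hα hρϖE hϖE hq hτα hd hddE hfixE hΘh₁ hh₁ hhyper hlam1 hjl hρc hc hlev hajl hρc' hc' hlev2 hn hb hJ,
    axis_lev_eq_sum_table_unr_aniso hρρ hvρ hΘΘ hΘρ hvΘ hα1 hα hρϖE hϖE hq hτα hd hddE hfixE hΘh₂ hh₂ haniso hlam1 hjl hρc hc hlev hajl hρc' hc' hlev2 hn hb hJ]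
  exact sum_unr_hyper_rowZero_add_eq_low q hJd

open scoped Classical in
/-- **(T5-P-axis-Δ) TYPE U, HIGH REGIME `d ≤ J′`**: `AX(h₁) + q^{d−1} = AX(h₂) + (q+1)·q^{d−1}·Σ_{k<(J′−d)∕2+1} q^k` (hyperbolic `h₁`, anisotropic `h₂`; `d ≥ 1` is in the package).
[cite: Kottwitz1986BaseChangeUnits, §1 pp. 240–241] [cite: LabesseLanglands1979, §2 pp. 7–8] [cite: Flicker1998UnitaryFL, Prop. 7 p. 84] -/
theorem axis_lev_unr_hyper_add_eq_aniso_add_of_le {d q : ℕ} [CompleteSpace K] [IsDiscreteValuationRing 𝒪[K]] [Finite 𝓀[K]]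
    (hρρ : ∀ x, ρ (ρ x) = x) (hvρ : ∀ x, Valued.v (ρ x) = Valued.v x) (hΘΘ : ∀ x, Θ (Θ x) = x) (hΘρ : ∀ x, Θ (ρ x) = ρ (Θ x))
    (hvΘ : ∀ x, Valued.v (Θ x) = Valued.v x) (hα1 : Valued.v α ≤ 1) (hα : Valued.v (α - ρ α) = 1)
    (hρϖE : ρ ϖE = ϖE) (hϖE : Valued.v ϖE = exp (-1 : ℤ)) (hq : Nat.card 𝓀[K] = q ^ 2)
    (hτα : Valued.v (ρ α - Θ α) < 1) (hd : 1 ≤ d) (hddE : Valued.v (ϖE - Θ ϖE) = Valued.v ϖE ^ d)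
    (hfixE : ∀ z : K, ρ z = z → Θ z = z → z ≠ 0 → ∃ n : ℤ, Valued.v z = exp (2 * n))
    {h₁ : K} (hΘh₁ : Θ h₁ = h₁) (hh₁ : h₁ ≠ 0) (hhyper : ∃ x : K, x ≠ 0 ∧ h₁ * Θ x * x + ρ (h₁ * Θ x * x) = 0)
    {h₂ : K} (hΘh₂ : Θ h₂ = h₂) (hh₂ : h₂ ≠ 0) (haniso : ¬ ∃ x : K, x ≠ 0 ∧ h₂ * Θ x * x + ρ (h₂ * Θ x * x) = 0)
    {lam : K} (hlam1 : Valued.v lam ≤ 1) {jl : ℕ} (hjl : Valued.v (lam - ρ lam) = Valued.v ϖE ^ jl * Valued.v (α - ρ α))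
    {c : K} (hρc : ρ c = c) {a : ℕ} (hc : Valued.v c = Valued.v ϖE ^ a) (hlev : Valued.v (lam - 1) ≤ Valued.v c) (hajl : a ≤ jl)
    {c' : K} (hρc' : ρ c' = c') {b : ℕ} (hc' : Valued.v c' = Valued.v ϖE ^ b) (hlev2 : Valued.v ((lam - 1) * (lam - 1)) ≤ Valued.v c')
    {n : ℕ} (hn : Valued.v (lam + ρ lam - 2) = Valued.v ϖE ^ n) (hb : b ≤ jl + n) {J : ℕ} (hJ : jl ≤ J)
    (hdJ : d ≤ min (jl - a) (jl + n - b)) :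
    ∑ j ∈ Finset.range (J + 1),
        (if IsOrd ρ α (ϖE ^ j) lam ∧ IsOrd ρ α (ϖE ^ j) (c⁻¹ * (lam - 1)) ∧ IsOrd ρ α (ϖE ^ j) (c'⁻¹ * ((lam - 1) * (lam - 1))) then
          (levelSet ρ Θ α ϖE h₁ j 0).ncard else 0) + q ^ (d - 1) =
      ∑ j ∈ Finset.range (J + 1),
        (if IsOrd ρ α (ϖE ^ j) lam ∧ IsOrd ρ α (ϖE ^ j) (c⁻¹ * (lam - 1)) ∧ IsOrd ρ α (ϖE ^ j) (c'⁻¹ * ((lam - 1) * (lam - 1))) then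
          (levelSet ρ Θ α ϖE h₂ j 0).ncard else 0) +
        (q + 1) * q ^ (d - 1) * ∑ k ∈ Finset.range ((min (jl - a) (jl + n - b) - d) / 2 + 1), q ^ k := by
  rw [axis_lev_eq_sum_table_unr_hyper hρρ hvρ hΘΘ hΘρ hvΘ hα1 hα hρϖE hϖE hq hτα hd hddE hfixE hΘh₁ hh₁ hhyper hlam1 hjl hρc hc hlev hajl hρc' hc' hlev2 hn hb hJ,
    axis_lev_eq_sum_table_unr_aniso hρρ hvρ hΘΘ hΘρ hvΘ hα1 hα hρϖE hϖE hq hτα hd hddE hfixE hΘh₂ hh₂ haniso hlam1 hjl hρc hc hlev hajl hρc' hc' hlev2 hn hb hJ]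
  exact sum_unr_hyper_rowZero_add_eq_high q hd hdJ

open scoped Classical in
/-- **(T5-P-axis-Δ) TYPE RamM**: for an `hnP`-side scalar `h₁` (class letters `hclsT₁`) and an `hnM`-side scalar `h₂` (class letters `hclsE₂` with the non-norm unit `n₀`)
over one line model, `AX(h₁) = AX(h₂) + 2·q^{s0}·Σ_{i ∈ Ico g ((J′−s0)∕2+1)} q^i` (`dΘ = 2g`, `2d′ = dρ + 2s0`; `g ≥ 1` from the `Θ`-datum).  Packages of ★ `ncard_levelSet_eq_hnP ∕
_eq_hnM` VERBATIM (frame shared; per-scalar letters `hvh, he, hcls0, hclsT∕E, hclsO` twice), then ★ p859438's §1 tokens.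
[cite: Kottwitz1986BaseChangeUnits, §1 pp. 240–241] [cite: Flicker1998UnitaryFL, Prop. 7 p. 84] [cite: Serre1979, Ch. V §3] -/
theorem axis_lev_ramM_hnP_eq_hnM_add {dρ t : ℕ} {K' : Type*} [Field K'] [Valued K' ℤᵐ⁰] {σ' : K' →+* K'} {π' : K'} {d' : ℕ} [CompleteSpace K] [IsDiscreteValuationRing 𝒪[K]] [Finite 𝓀[K]] [IsDiscreteValuationRing 𝒪[K']] [Finite 𝓀[K']]
    (hD : IsRamifiedQuadraticDatum ρ α dρ t) (hΘρ : ∀ x, Θ (ρ x) = ρ (Θ x)) (hvΘ : ∀ x, Valued.v (Θ x) = Valued.v x)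
    (hϖE : Valued.v ϖE = exp (-2 : ℤ)) (hρϖ : ρ ϖE = ϖE) {q : ℕ} (hq : Nat.card 𝓀[K] = q) (hq' : Nat.card 𝓀[K'] = q) (hq2 : 2 ∣ q)
    (hσ' : ∀ x, σ' (σ' x) = x) (hvσ' : ∀ x, Valued.v (σ' x) = Valued.v x) (hfix' : ∀ x : K', σ' x = x → x ≠ 0 → ∃ n : ℤ, Valued.v x = exp (2 * n))
    (hπ' : Valued.v π' = exp (-1 : ℤ)) (hdd' : Valued.v (π' - σ' π') = Valued.v π' ^ d')
    (jK : K' →+* K) (hjle : ∀ x y : K', Valued.v (jK x) ≤ Valued.v (jK y) ↔ Valued.v x ≤ Valued.v y) (hjΘ : ∀ x, Θ (jK x) = jK x)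
    (hjfix : ∀ z : K, Θ z = z → ∃ x, jK x = z) (hjσ : ∀ x, jK (σ' x) = ρ (jK x)) (hjπ : Valued.v (jK π') = exp (-2 : ℤ))
    {ϖ : K} {dΘ tΘ : ℕ} (hDΘ : IsRamifiedQuadraticDatum Θ ϖ dΘ tΘ)
    (hFN : ∀ f : K, ρ f = f → Θ f = f → Valued.v f = 1 → ∃ x : K, x * Θ x = f)
    {n₀ : K} (hΘn₀ : Θ n₀ = n₀) (hn₀1 : Valued.v n₀ = 1) (hn₀N : ¬ ∃ z : K, z * Θ z = n₀)
    {g s0 : ℕ} (hg : dΘ = 2 * g) (hds : 2 * d' = dρ + 2 * s0) (hs1 : 1 ≤ s0)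
    {h₁ : K} (hΘh₁ : Θ h₁ = h₁) (hh₁ : h₁ ≠ 0) {vh₁ : ℤ} (hvh₁ : Valued.v h₁ = exp (-vh₁)) {e₁ : ℤ} (he₁ : vh₁ + dρ = 2 * e₁)
    (hcls0₁ : ∀ k₀ : ℤ, Valued.v (1 + ρ h₁ / h₁ * (ρ (α ^ k₀ * Θ (α ^ k₀)) / (α ^ k₀ * Θ (α ^ k₀)))) ≤ exp (-(2 * (d' : ℤ) - 2)))
    (hclsT₁ : ∀ k₀ : ℤ, (∃ r : ℤ, k₀ + s0 + e₁ = 2 * r) → ∃ ω₀ : Kˣ, Valued.v (ω₀ : K) = 1 ∧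
      ρ h₁ / h₁ * (ρ (α ^ k₀ * Θ (α ^ k₀)) / (α ^ k₀ * Θ (α ^ k₀))) * (ρ ((ω₀ : K) * Θ ω₀) / ((ω₀ : K) * Θ ω₀)) = -1)
    (hclsO₁ : ∀ k₀ : ℤ, (∃ r : ℤ, k₀ + s0 + e₁ = 2 * r + 1) → ∀ ω : Kˣ, Valued.v (ω : K) = 1 →
      ¬ Valued.v (1 + ρ h₁ / h₁ * (ρ (α ^ k₀ * Θ (α ^ k₀)) / (α ^ k₀ * Θ (α ^ k₀))) * (ρ ((ω : K) * Θ ω) / ((ω : K) * Θ ω))) ≤ exp (-(2 * (d' : ℤ))))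
    {h₂ : K} (hΘh₂ : Θ h₂ = h₂) (hh₂ : h₂ ≠ 0) {vh₂ : ℤ} (hvh₂ : Valued.v h₂ = exp (-vh₂)) {e₂ : ℤ} (he₂ : vh₂ + dρ = 2 * e₂)
    (hcls0₂ : ∀ k₀ : ℤ, Valued.v (1 + ρ h₂ / h₂ * (ρ (α ^ k₀ * Θ (α ^ k₀)) / (α ^ k₀ * Θ (α ^ k₀)))) ≤ exp (-(2 * (d' : ℤ) - 2)))
    (hclsE₂ : ∀ k₀ : ℤ, (∃ r : ℤ, k₀ + s0 + e₂ = 2 * r) → ∃ ω₀ : Kˣ, Valued.v (ω₀ : K) = 1 ∧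
      ρ h₂ / h₂ * (ρ (α ^ k₀ * Θ (α ^ k₀)) / (α ^ k₀ * Θ (α ^ k₀))) * (ρ ((ω₀ : K) * Θ ω₀) / ((ω₀ : K) * Θ ω₀)) * (ρ n₀ / n₀) = -1)
    (hclsO₂ : ∀ k₀ : ℤ, (∃ r : ℤ, k₀ + s0 + e₂ = 2 * r + 1) → ∀ ω : Kˣ, Valued.v (ω : K) = 1 →
      ¬ Valued.v (1 + ρ h₂ / h₂ * (ρ (α ^ k₀ * Θ (α ^ k₀)) / (α ^ k₀ * Θ (α ^ k₀))) * (ρ ((ω : K) * Θ ω) / ((ω : K) * Θ ω))) ≤ exp (-(2 * (d' : ℤ))))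
    {lam : K} (hlam1 : Valued.v lam ≤ 1) {jl : ℕ} (hjl : Valued.v (lam - ρ lam) = Valued.v ϖE ^ jl * Valued.v (α - ρ α))
    {c : K} (hρc : ρ c = c) {a : ℕ} (hc : Valued.v c = Valued.v ϖE ^ a) (hlev : Valued.v (lam - 1) ≤ Valued.v c) (hajl : a ≤ jl)
    {c' : K} (hρc' : ρ c' = c') {b : ℕ} (hc' : Valued.v c' = Valued.v ϖE ^ b) (hlev2 : Valued.v ((lam - 1) * (lam - 1)) ≤ Valued.v c')
    {n : ℕ} (hn : Valued.v (lam + ρ lam - 2) = Valued.v ϖE ^ n) (hb : b ≤ jl + n) {J : ℕ} (hJ : jl ≤ J) :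
    ∑ j ∈ Finset.range (J + 1),
        (if IsOrd ρ α (ϖE ^ j) lam ∧ IsOrd ρ α (ϖE ^ j) (c⁻¹ * (lam - 1)) ∧ IsOrd ρ α (ϖE ^ j) (c'⁻¹ * ((lam - 1) * (lam - 1))) then
          (levelSet ρ Θ α ϖE h₁ j 0).ncard else 0) =
      ∑ j ∈ Finset.range (J + 1),
        (if IsOrd ρ α (ϖE ^ j) lam ∧ IsOrd ρ α (ϖE ^ j) (c⁻¹ * (lam - 1)) ∧ IsOrd ρ α (ϖE ^ j) (c'⁻¹ * ((lam - 1) * (lam - 1))) then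
          (levelSet ρ Θ α ϖE h₂ j 0).ncard else 0) +
        2 * q ^ s0 * ∑ i ∈ Finset.Ico g ((min (jl - a) (jl + n - b) - s0) / 2 + 1), q ^ i := by
  have hg1 : 1 ≤ g := by have := hDΘ.2.2.2.2.2.1; omega
  rw [axis_lev_eq_sum_table_ramM_hnP hD hΘρ hvΘ hϖE hρϖ hq hq' hq2 hσ' hvσ' hfix' hπ' hdd' jK hjle hjΘ hjfix hjσ hjπ hDΘ hFN hΘh₁ hh₁ hvh₁ he₁ hg hds hs1
      hcls0₁ hclsT₁ hclsO₁ hlam1 hjl hρc hc hlev hajl hρc' hc' hlev2 hn hb hJ,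
    axis_lev_eq_sum_table_ramM_hnM hD hΘρ hvΘ hϖE hρϖ hq hq' hσ' hvσ' hfix' hπ' hdd' jK hjle hjΘ hjfix hjσ hjπ hDΘ hFN hΘn₀ hn₀1 hn₀N hΘh₂ hh₂ hvh₂ he₂ hg hds hs1
      hcls0₂ hclsE₂ hclsO₂ hlam1 hjl hρc hc hlev hajl hρc' hc' hlev2 hn hb hJ,
    sum_ramM_rowZero_hnP_eq_sum_hnM_add q _ hg1 hs1]

end Summit.HodgeConjecture.HodgeConjecture.Cruxes.H413.F0P3cDyRamJointProfileCensusAxisDifference
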